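import Summits.CriticalPhenomena.PercolationContinuityZ3.Theorems.Transplant.SkelFrmBParamsCorrKGLen
import Summits.CriticalPhenomena.PercolationContinuityZ3.Theorems.Transplant.SkelNegParamsLattice
import HarnessLib

/-!
# N2 (frames-only node `SamePDropOfSkeletonFrm₁`, OPEN) — (ζ″) ledger, THE K-G CORRIDOR'S LENGTH BUDGET, SECOND AXIS: closed bounds on p5-g16's
# second-axis step counts `m₁ + 1 = ⌊T₁/dec₁⌋`, `m₂ + 1 = max 1 ⌈(T − (P+ρ−1))/dec₂⌉` and the overshoot `X` (SkelPhiCorridorKGYValues), the run-length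
# bound **`kgNYv0 ≤ 21·K + 2`** (pitch `(20K·m)/U ≤ 20K(sL + 2)` by `m ≤ n_L·ℓ_L`, `NegPrm.modulus_vβOf`), and at the values of record (`ρ := 0`)
# **`kgSchedNY_le_LfQ : kgNYv0 + 1 + (m₁+1) + (m₂+1) ≤ NegB.LfQ κ.K₀`** (the N-corridor's `S.N + 1`, `kgCorrSchedY_params`) — the (R-34) budget `LfQ K₀ :=
# 80·Kcell K₀` of SkelFrmBParamsCorrKGLen serves BOTH axes.

* §1 (generic, `Skelφ.KGYRows.*_budget`): `kgM₁Y_budget : 2n(m₁+1) ≤ 3T₁` under `3(2R′+ρ) ≤ n`; `kgM₂Y_budget : (m₂+1)·dec₂ ≤ (T − (P+ρ−1)) + dec₂` under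
  `0 ≤ T − (P+ρ−1)`; `kgTY_sub_nonneg` (`ρ ≤ P + 1 ⇒ 0 ≤ T − (P+ρ−1)`); `kgM₁Y_succ_budget : 8(m₁+1) ≤ 1008 + 3(N+1)` under `W ≤ 42n`, `8R′ ≤ n`;
  `kgM₂Y_succ_budget : 2sL(m₂+1) ≤ 3T + 3` under `3(2R′+ρ) ≤ sL`, `ρ ≤ P+1`; `natDiv_le_kgSLY : ⌊nℓ/U⌋ ≤ sL + 1`; `sL_le_kgP : sL ≤ P`; **`kgSchedNY_budget : N + 1 + (m₁+1) + (m₂+1) ≤ 80·K`**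
  (`N ≤ 21K + 2`, `K ≥ 40`, `q ≤ 41sL + 2`, `958 ≤ sL`).
* §2 (values, `ρ := 0`): `KGResY` (`qx ≤ 40·sL`, `Wx ≤ 40·n_L`), `kgY_floors`, `pitchY_le`, **`kgNYv0_le : kgNYv0 ≤ 21·K + 2`**, **`kgSchedNY_le_LfQ`**.
builds on p205010 (kernel theorem, internal audit signed; external expert review pending) — nothing in this file uses p205010; NOTHING is claimed about the open
node `SamePDropOfSkeletonFrm₁`.
Lane `prim-bschramm`, seat `prim-bschramm-stmt` (gen 20); helper file (`--supports stmt-CriticalPhenomena-4575 --as helper`); ruling (R-34); ledger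
HOME/prim-bschramm-stmt/FRM-PARAMS.md.
[cite: KozmaNitzan2024, §4 Lemma 12 (pp. 23–25: the corridor's step counts)] [cite: MartineauTassion2017, §4.3 Lemma 4.2 (steering)]
-/

open scoped Classical

noncomputable section

namespace Summit.CriticalPhenomena.PercolationContinuityZ3.Theorems.Transplant

namespace Skelφ

/-! ## §1 Generic budgets over `KGYRows` -/

section BudgetY

variable {n ℓ : ℕ} {hs v : ℤ} {R' ρ q W : ℕ}

/-- **`2n·(m₁+1) ≤ 3·T₁`** (second axis) under `3(2R′+ρ) ≤ n` (`3·dec₁ ≥ 2n`, `(m₁+1)·dec₁ ≤ T₁`). [this work] -/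
theorem KGYRows.kgM₁Y_budget (H : KGYRows n ℓ hs v R' ρ q W) (hSn : 3 * (2 * (R' : ℤ) + ρ) ≤ n) (N : ℕ) :
    2 * (n : ℤ) * ((((kgM₁Y n v R' ρ W N : ℕ) : ℤ)) + 1) ≤ 3 * kgT₁Y v R' W N := by
  obtain ⟨he, -⟩ := H.kgM₁Y_spec N
  have hd := H.dec₁_pos.1
  have hρ0 : (0 : ℤ) ≤ ρ := by positivity
  have hd0 : 0 < kgDec₁Y n R' ρ := by linarith
  have hfl := Int.ediv_mul_le (kgT₁Y v R' W N) (ne_of_gt hd0)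
  rw [← he] at hfl
  have h3 : 2 * (n : ℤ) ≤ 3 * kgDec₁Y n R' ρ := by unfold kgDec₁Y; linarith
  have hm0 : (0 : ℤ) ≤ (((kgM₁Y n v R' ρ W N : ℕ) : ℤ)) + 1 := by positivity
  nlinarith

/-- `0 ≤ T − (P + ρ − 1)` whenever `ρ ≤ P + 1` (`T ≥ 2q ≥ 2P`). [folklore] -/
theorem KGYRows.kgTY_sub_nonneg (H : KGYRows n ℓ hs v R' ρ q W) (hρP : (ρ : ℤ) ≤ (n * ℓ / shearUnit n hs : ℕ) + 2) (N : ℕ) :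
    0 ≤ kgTY n ℓ hs v R' ρ q W N - ((n : ℤ) * ℓ / (shearUnit n hs : ℕ) + 1 + ρ - 1) := by
  have hq := H.hq
  have hqz : ((n * ℓ / shearUnit n hs + 1 : ℕ) : ℤ) ≤ q := by exact_mod_cast hq
  have hm0 : (0 : ℤ) ≤ ((((kgM₁Y n v R' ρ W N : ℕ) : ℤ)) + 1) * ((R' : ℤ) + ρ) := by positivity
  have hN0 : (0 : ℤ) ≤ ((N : ℤ) + 1) * R' := by positivity
  have hd0 : (0 : ℤ) ≤ ((N : ℤ) + 1) * (dS n ℓ hs : ℕ) := by positivity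
  have hdiv : (((n * ℓ / shearUnit n hs : ℕ) : ℤ)) = (n : ℤ) * ℓ / (shearUnit n hs : ℕ) := by push_cast; rfl
  unfold kgTY
  push_cast at hqz ⊢
  rw [← hdiv]
  linarith

/-- **`(m₂+1)·dec₂ ≤ (T − (P+ρ−1)) + dec₂`** (second axis), under `0 ≤ T − (P+ρ−1)`. [this work] -/
theorem KGYRows.kgM₂Y_budget (H : KGYRows n ℓ hs v R' ρ q W) (N : ℕ)
    (hT : 0 ≤ kgTY n ℓ hs v R' ρ q W N - ((n : ℤ) * ℓ / (shearUnit n hs : ℕ) + 1 + ρ - 1)) :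
    ((((kgM₂Y n ℓ hs v R' ρ q W N : ℕ) : ℤ)) + 1) * kgDec₂Y n ℓ hs R' ρ ≤
      (kgTY n ℓ hs v R' ρ q W N - ((n : ℤ) * ℓ / (shearUnit n hs : ℕ) + 1 + ρ - 1)) + kgDec₂Y n ℓ hs R' ρ := by
  obtain ⟨he, -⟩ := H.kgM₂Y_spec N
  have hd := H.dec₂_pos
  have hρ0 : (0 : ℤ) ≤ ρ := by positivity
  have hd0 : 0 < kgDec₂Y n ℓ hs R' ρ := by linarith
  set T := kgTY n ℓ hs v R' ρ q W N - ((n : ℤ) * ℓ / (shearUnit n hs : ℕ) + 1 + ρ - 1) with hTdef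
  rcases le_or_gt ((T + kgDec₂Y n ℓ hs R' ρ - 1) / kgDec₂Y n ℓ hs R' ρ) 1 with hle | hlt
  · rw [max_eq_left hle] at he
    rw [he]; linarith
  · rw [max_eq_right hlt.le] at he
    have hfl := Int.ediv_mul_le (T + kgDec₂Y n ℓ hs R' ρ - 1) (ne_of_gt hd0)
    rw [← he] at hfl
    linarith

/-- **`8·(m₁+1) ≤ 1008 + 3(N+1)`** (second axis) under `3(2R′+ρ) ≤ n`, `W ≤ 42n`, `8R′ ≤ n`. [this work] -/
theorem KGYRows.kgM₁Y_succ_budget (H : KGYRows n ℓ hs v R' ρ q W) (hSn : 3 * (2 * (R' : ℤ) + ρ) ≤ n) (hW : (W : ℤ) ≤ 42 * n)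
    (hR8 : 8 * (R' : ℤ) ≤ n) (N : ℕ) :
    8 * ((((kgM₁Y n v R' ρ W N : ℕ) : ℤ)) + 1) ≤ 1008 + 3 * ((N : ℤ) + 1) := by
  have hb := H.kgM₁Y_budget hSn N
  have hn : (1 : ℤ) ≤ n := by exact_mod_cast H.hn
  have ha : (0 : ℤ) ≤ |v| := abs_nonneg _
  have hN0 : (0 : ℤ) ≤ (N : ℤ) + 1 := by positivity
  unfold kgT₁Y at hb
  have h1 : 8 * (2 * (n : ℤ) * ((((kgM₁Y n v R' ρ W N : ℕ) : ℤ)) + 1)) ≤ (n : ℤ) * (2016 + 6 * ((N : ℤ) + 1)) := by nlinarith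
  have h2 : (n : ℤ) * (16 * ((((kgM₁Y n v R' ρ W N : ℕ) : ℤ)) + 1)) ≤ (n : ℤ) * (2016 + 6 * ((N : ℤ) + 1)) := by linarith
  have := le_of_mul_le_mul_left h2 (by linarith)
  linarith

/-- `⌊nℓ/U⌋ ≤ sL + 1` (`sL = ⌊(nℓ − U + 1)/U⌋`). [folklore] -/
theorem natDiv_le_kgSLY {n : ℕ} (hn : 1 ≤ n) (ℓ : ℕ) (hs : ℤ) : ((n * ℓ / shearUnit n hs : ℕ) : ℤ) ≤ kgSLY n ℓ hs + 1 := by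
  have hU : (0 : ℤ) < (shearUnit n hs : ℕ) := shearUnit_pos hn hs
  have hdiv : ((n * ℓ / shearUnit n hs : ℕ) : ℤ) = (n : ℤ) * ℓ / (shearUnit n hs : ℕ) := by push_cast; rfl
  rw [hdiv]
  have hlt := Int.lt_ediv_add_one_mul_self ((n : ℤ) * ℓ - (shearUnit n hs : ℕ) + 1) hU
  have e : ((n : ℤ) * ℓ - (shearUnit n hs : ℕ) + 1) / (shearUnit n hs : ℕ) = kgSLY n ℓ hs := rfl
  rw [e] at hlt
  have h2 : (n : ℤ) * ℓ < (kgSLY n ℓ hs + 2) * (shearUnit n hs : ℕ) := by nlinarith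
  have := Int.ediv_lt_of_lt_mul hU h2
  linarith

/-- `sL ≤ P` (`⌊(nℓ − U + 1)/U⌋ ≤ ⌊nℓ/U⌋ + 1`). [folklore] -/
theorem KGYRows.sL_le_kgP (H : KGYRows n ℓ hs v R' ρ q W) : kgSLY n ℓ hs ≤ ((n * ℓ / shearUnit n hs : ℕ) : ℤ) + 1 := by
  have hn := H.hn
  have hU : (0 : ℤ) < (shearUnit n hs : ℕ) := shearUnit_pos hn hs
  have hdiv : (((n * ℓ / shearUnit n hs : ℕ) : ℤ)) = (n : ℤ) * ℓ / (shearUnit n hs : ℕ) := by push_cast; rfl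
  rw [hdiv]
  unfold kgSLY
  have h1 : ((n : ℤ) * ℓ - (shearUnit n hs : ℕ) + 1) / (shearUnit n hs : ℕ) ≤ ((n : ℤ) * ℓ) / (shearUnit n hs : ℕ) :=
    Int.ediv_le_ediv hU (by linarith)
  linarith

/-- **`2sL·(m₂+1) ≤ 3·T + 3`** (second axis) under `3(2R′+ρ) ≤ sL` (`3·dec₂ ≥ 2sL`) and `ρ ≤ P + 1`. [this work] -/
theorem KGYRows.kgM₂Y_succ_budget (H : KGYRows n ℓ hs v R' ρ q W) (hS : 3 * (2 * (R' : ℤ) + ρ) ≤ kgSLY n ℓ hs)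
    (hρP : (ρ : ℤ) ≤ (n * ℓ / shearUnit n hs : ℕ) + 2) (N : ℕ) :
    2 * kgSLY n ℓ hs * ((((kgM₂Y n ℓ hs v R' ρ q W N : ℕ) : ℤ)) + 1) ≤ 3 * kgTY n ℓ hs v R' ρ q W N + 3 := by
  have hT := H.kgTY_sub_nonneg hρP N
  have hb := H.kgM₂Y_budget N hT
  have hd := H.dec₂_pos
  have hρ0 : (0 : ℤ) ≤ ρ := by positivity
  have hd0 : 0 < kgDec₂Y n ℓ hs R' ρ := by linarith
  have hA0 : (0 : ℤ) ≤ (((kgM₂Y n ℓ hs v R' ρ q W N : ℕ) : ℤ)) + 1 := by positivity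
  have h3 : 2 * kgSLY n ℓ hs ≤ 3 * kgDec₂Y n ℓ hs R' ρ := by unfold kgDec₂Y; linarith
  have hP := H.sL_le_kgP
  have hdiv : (((n * ℓ / shearUnit n hs : ℕ) : ℤ)) = (n : ℤ) * ℓ / (shearUnit n hs : ℕ) := by push_cast; rfl
  have h4 : 2 * kgSLY n ℓ hs * ((((kgM₂Y n ℓ hs v R' ρ q W N : ℕ) : ℤ)) + 1) ≤
      3 * (((((kgM₂Y n ℓ hs v R' ρ q W N : ℕ) : ℤ)) + 1) * kgDec₂Y n ℓ hs R' ρ) := by nlinarith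
  have h5 : kgDec₂Y n ℓ hs R' ρ ≤ kgSLY n ℓ hs := by unfold kgDec₂Y; linarith
  rw [hdiv] at hP hρP
  nlinarith

/-- **THE LENGTH BUDGET, generic, second axis**: `N + 1 + (m₁+1) + (m₂+1) ≤ 80·K` whenever `N ≤ 21K + 2`, `K ≥ 40`, under `3(2R′+ρ) ≤ n`, `3(2R′+ρ) ≤ sL`,
`8R′ ≤ n`, `W ≤ 42n`, `q ≤ 41sL + 2`, `ρ ≤ P + 1`, `958 ≤ sL` (so `m₁+1 ≤ 126 + 3(N+1)/8`, `m₂+1 ≤ 124 + (N+1) + (m₁+1)`). [this work] -/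
theorem KGYRows.kgSchedNY_budget (H : KGYRows n ℓ hs v R' ρ q W) (hSn : 3 * (2 * (R' : ℤ) + ρ) ≤ n) (hS : 3 * (2 * (R' : ℤ) + ρ) ≤ kgSLY n ℓ hs)
    (hR8 : 8 * (R' : ℤ) ≤ n) (hW : (W : ℤ) ≤ 42 * n) (hq : (q : ℤ) ≤ 41 * kgSLY n ℓ hs + 2) (hρP : (ρ : ℤ) ≤ (n * ℓ / shearUnit n hs : ℕ) + 2)
    (hbig : 958 ≤ kgSLY n ℓ hs) {K : ℤ} (hK : 40 ≤ K) (N : ℕ) (hNK : (N : ℤ) ≤ 21 * K + 2) :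
    (N : ℤ) + 1 + ((((kgM₁Y n v R' ρ W N : ℕ) : ℤ)) + 1) + ((((kgM₂Y n ℓ hs v R' ρ q W N : ℕ) : ℤ)) + 1) ≤ 80 * K := by
  have f1 := H.kgM₁Y_succ_budget hSn hW hR8 N
  have f2 := H.kgM₂Y_succ_budget hS hρP N
  have hR0 : (0 : ℤ) ≤ R' := by positivity
  have hρ0 : (0 : ℤ) ≤ ρ := by positivity
  have hdS : ((dS n ℓ hs : ℕ) : ℤ) ≤ 2 := by exact_mod_cast dS_le_two n ℓ hs
  have hdS0 : (0 : ℤ) ≤ ((dS n ℓ hs : ℕ) : ℤ) := by positivity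
  set a := (((kgM₁Y n v R' ρ W N : ℕ) : ℤ)) + 1 with ha_def
  set b := (((kgM₂Y n ℓ hs v R' ρ q W N : ℕ) : ℤ)) + 1 with hb_def
  set s := kgSLY n ℓ hs with hs_def
  have ha0 : 0 ≤ a := by positivity
  have hb0 : 0 ≤ b := by positivity
  have hN0 : (0 : ℤ) ≤ (N : ℤ) + 1 := by positivity
  -- T = 2q + 2(N+1)R′ + (N+1)dS + 2a(R′+ρ)
  have hT : kgTY n ℓ hs v R' ρ q W N = 2 * (q : ℤ) + 2 * (((N : ℤ) + 1) * R') + ((N : ℤ) + 1) * (dS n ℓ hs : ℕ) + 2 * (a * ((R' : ℤ) + ρ)) := by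
    unfold kgTY; ring
  have g1 : 3 * (a * ((R' : ℤ) + ρ)) ≤ a * s := by nlinarith
  have g2 : 6 * (((N : ℤ) + 1) * R') ≤ ((N : ℤ) + 1) * s := by nlinarith
  have g3 : 3 * (((N : ℤ) + 1) * (dS n ℓ hs : ℕ)) ≤ ((N : ℤ) + 1) * s := by nlinarith
  -- 2 s b ≤ 3T + 3 ≤ (247 + 2(N+1) + 2a)·s  (6q + 3 ≤ 246 s + 15 ≤ 247 s, 6(N+1)R′ ≤ (N+1)s, 3(N+1)dS ≤ (N+1)s, 6a(R′+ρ) ≤ 2as)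
  have g5 : 2 * s * b ≤ (247 + 2 * ((N : ℤ) + 1) + 2 * a) * s := by rw [hT] at f2; nlinarith
  have g6 : 2 * b ≤ 247 + 2 * ((N : ℤ) + 1) + 2 * a := by
    have : s * (2 * b) ≤ s * (247 + 2 * ((N : ℤ) + 1) + 2 * a) := by nlinarith
    exact le_of_mul_le_mul_left this (by linarith)
  linarith

end BudgetY

end Skelφ

/-! ## §2 At the values of record (`ρ := 0`): the second-axis run length and budget -/

namespace PlanarSkeletonFrm

namespace NegB

open Literature.Probability.Percolation Literature.Probability.LatticeModels SimpleGraph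
open SkelConc (Consts)
open Skelφ (shearUnit kgSL kgSLY kgΔY kgNY kgFarY kgTY kgM₁Y kgM₂Y KGYRows)
open Neg

section ValuesY

variable (κ : Consts) {V : Type} [DecidableEq V] [Countable V] {G : SimpleGraph V} [G.LocallyFinite] (Φ : PlanarSkeletonFrm G) (t : V) (p : unitInterval)
  (D : Skelφ.StepI.DataNS V) (g f mk qx Wx : ℕ)

/-- **The second-axis residual floors**: `qx ≤ 40·sL` (rows) and `Wx ≤ 40·n_L` (x′ units). [this work] -/
structure KGResY : Prop where
  /-- `qx ≤ 40·sL` -/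
  hqx : (qx : ℤ) ≤ 40 * kgSLY (nL κ Φ t p D g f) (ℓL κ Φ t p D g f) (hL κ Φ t p D g f)
  /-- `Wx ≤ 40·n_L` -/
  hWx : Wx ≤ 40 * nL κ Φ t p D g f

/-- The generic floors at the values, second axis (`ρ := 0`): `3(2R′+0) ≤ n_L`, `3(2R′+0) ≤ sL`, `8R′ ≤ n_L`, `958 ≤ sL`, `0 ≤ P + 2`. [folklore] -/
theorem kgY_floors (hN : EqNumL κ Φ t p D g f) (hg : gFloorKG κ Φ t p D mk ≤ g) :
    3 * (2 * ((kgR κ Φ t p D mk : ℕ) : ℤ) + ((0 : ℕ) : ℤ)) ≤ (nL κ Φ t p D g f : ℤ) ∧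
    3 * (2 * ((kgR κ Φ t p D mk : ℕ) : ℤ) + ((0 : ℕ) : ℤ)) ≤ kgSLY (nL κ Φ t p D g f) (ℓL κ Φ t p D g f) (hL κ Φ t p D g f) ∧
    8 * ((kgR κ Φ t p D mk : ℕ) : ℤ) ≤ (nL κ Φ t p D g f : ℤ) ∧
    958 ≤ kgSLY (nL κ Φ t p D g f) (ℓL κ Φ t p D g f) (hL κ Φ t p D g f) ∧
    (((0 : ℕ) : ℤ)) ≤ ((nL κ Φ t p D g f * ℓL κ Φ t p D g f / shearUnit (nL κ Φ t p D g f) (hL κ Φ t p D g f) : ℕ) : ℤ) + 2 := by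
  have hnle := hN.n_le
  have hgML : g ≤ ML κ Φ t p D g := (ML_le_ML κ Φ t p D g).2
  have hsL := ML_sub_one_le_kgSL κ Φ t p D g f hN
  have h960 := slack_floor_le_ML κ Φ t p D g
  have h959 : (959 : ℤ) ≤ ML κ Φ t p D g := by
    have : 959 ≤ ML κ Φ t p D g := by omega
    exact_mod_cast this
  unfold gFloorKG at hg
  have hfl : ((8 * KS0.R'0 κ Φ t p D mk + 3 * Mu D + 6 : ℕ) : ℤ) ≤ ML κ Φ t p D g := by exact_mod_cast hg.trans hgML
  push_cast at hfl
  rw [kgSLY_eq_kgSL]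
  unfold kgR
  have hM0 : (0 : ℤ) ≤ (Mu D : ℤ) := by positivity
  push_cast
  refine ⟨by linarith, by linarith, by linarith, by linarith, by positivity⟩

/-- **`pitchY ≤ 20·K·(sL + 2)`** (`m ≤ n_L·ℓ_L` by `modulus_vβOf`, and `n_Lℓ_L ≤ (sL + 2)·U − 2`). [this work] -/
theorem pitchY_le (hN : EqNumL κ Φ t p D g f) :
    pitchY κ Φ t p D g f ≤ 20 * (Neg.K κ : ℤ) * (kgSLY (nL κ Φ t p D g f) (ℓL κ Φ t p D g f) (hL κ Φ t p D g f) + 2) := by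
  obtain ⟨hn1, -⟩ := one_le_of_eqNumL κ Φ t p D g f hN
  have hm := (Skelφ.NegPrm.modulus_vβOf hn1 (hL κ Φ t p D g f) (ℓL κ Φ t p D g f) (vL κ Φ t p D g f)).2
  have hU : (0 : ℤ) < (shearUnit (nL κ Φ t p D g f) (hL κ Φ t p D g f) : ℕ) := Skelφ.shearUnit_pos hn1 _
  have hK0 : (0 : ℤ) ≤ (Neg.K κ : ℤ) := by positivity
  unfold pitchY
  -- sL = ⌊(nℓ − U + 1)/U⌋ ⇒ nℓ − U + 1 < (sL + 1)·U ⇒ nℓ ≤ (sL + 2)·U − 2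
  have hlt := Int.lt_ediv_add_one_mul_self ((nL κ Φ t p D g f : ℤ) * ℓL κ Φ t p D g f - (shearUnit (nL κ Φ t p D g f) (hL κ Φ t p D g f) : ℕ) + 1) hU
  have e : ((nL κ Φ t p D g f : ℤ) * ℓL κ Φ t p D g f - (shearUnit (nL κ Φ t p D g f) (hL κ Φ t p D g f) : ℕ) + 1) /
      (shearUnit (nL κ Φ t p D g f) (hL κ Φ t p D g f) : ℕ) = kgSLY (nL κ Φ t p D g f) (ℓL κ Φ t p D g f) (hL κ Φ t p D g f) := rfl
  rw [e] at hlt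
  apply Int.ediv_le_of_le_mul hU
  have : vβL κ Φ t p D g f = Skelφ.NegPrm.vβOf (nL κ Φ t p D g f) (hL κ Φ t p D g f) (ℓL κ Φ t p D g f) (vL κ Φ t p D g f) := rfl
  rw [this]
  nlinarith

/-- **`kgNYv0 ≤ 21·K + 2`**. [this work] -/
theorem kgNYv0_le (hN : EqNumL κ Φ t p D g f) (hg : gFloorKG κ Φ t p D mk ≤ g) : kgNYv0 κ Φ t p D g f mk qx Wx ≤ 21 * Neg.K κ + 2 := by
  refine (kgNYv0_le_div κ Φ t p D g f mk qx Wx).trans ?_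
  obtain ⟨hn1, -⟩ := one_le_of_eqNumL κ Φ t p D g f hN
  obtain ⟨-, hS, -, hbig, -⟩ := kgY_floors κ Φ t p D g f mk hN hg
  have H := kgYRows0_of κ Φ t p D g f mk qx Wx hN hg
  have hP := H.sL_le_kgP
  have hpy := pitchY_le κ Φ t p D g f hN
  have hK := (Skelφ.NegPrm.forty_le_Kcell κ.K₀).1
  have hK' : (40 : ℤ) ≤ (Neg.K κ : ℤ) := by unfold Neg.K; exact_mod_cast hK
  set s := kgSLY (nL κ Φ t p D g f) (ℓL κ Φ t p D g f) (hL κ Φ t p D g f) with hs_def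
  have hs0 : 0 ≤ s := by linarith
  have hPd := Skelφ.natDiv_le_kgSLY hn1 (ℓL κ Φ t p D g f) (hL κ Φ t p D g f)
  have hPd0 : (0 : ℤ) ≤ ((nL κ Φ t p D g f * ℓL κ Φ t p D g f / shearUnit (nL κ Φ t p D g f) (hL κ Φ t p D g f) : ℕ) : ℤ) := by positivity
  set Pd := ((nL κ Φ t p D g f * ℓL κ Φ t p D g f / shearUnit (nL κ Φ t p D g f) (hL κ Φ t p D g f) : ℕ) : ℤ) with hPd_def
  have hR6 : 6 * ((KS0.R'0 κ Φ t p D mk : ℕ) : ℤ) ≤ s := by unfold kgR at hS; push_cast at hS; linarith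
  have hsk : 40 * (Neg.K κ : ℤ) + 3 ≤ s * (Neg.K κ : ℤ) - s := by
    nlinarith [mul_nonneg (sub_nonneg.2 hbig) (sub_nonneg.2 (show (1 : ℤ) ≤ (Neg.K κ : ℤ) by linarith))]
  have hT1 : (((nL κ Φ t p D g f * ℓL κ Φ t p D g f / shearUnit (nL κ Φ t p D g f) (hL κ Φ t p D g f) + 1 : ℕ) : ℤ) - 1) / 2 ≤ s + 1 := by
    have e : (((nL κ Φ t p D g f * ℓL κ Φ t p D g f / shearUnit (nL κ Φ t p D g f) (hL κ Φ t p D g f) + 1 : ℕ) : ℤ) - 1) = Pd := by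
      rw [hPd_def]; push_cast; ring
    rw [e]
    have := Int.ediv_le_self 2 hPd0
    linarith
  have hT2 : (s + kgΔY (kgR κ Φ t p D mk) 0) / 2 ≤ s + kgΔY (kgR κ Φ t p D mk) 0 :=
    Int.ediv_le_self 2 (by unfold Skelφ.kgΔY; positivity)
  have hΔ : kgΔY (kgR κ Φ t p D mk) 0 = 3 * ((KS0.R'0 κ Φ t p D mk : ℕ) : ℤ) + 2 := by unfold Skelφ.kgΔY kgR; push_cast; ring
  have htgt : kgTgtY0 κ Φ t p D g f mk ≤ s * (21 * Neg.K κ + 2) := by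
    unfold kgTgtY0
    rw [hΔ] at hT2
    rw [hΔ]
    nlinarith
  have h0 : 0 ≤ kgTgtY0 κ Φ t p D g f mk := by
    unfold kgTgtY0
    have hpy0 : 0 ≤ pitchY κ Φ t p D g f := by
      unfold pitchY
      apply Int.ediv_nonneg _ (by positivity)
      have hm0 := (Skelφ.NegPrm.modulus_vβOf_pos hn1 (one_le_of_eqNumL κ Φ t p D g f hN).2 (hL κ Φ t p D g f) (vL κ Φ t p D g f)).le
      have : vβL κ Φ t p D g f = Skelφ.NegPrm.vβOf (nL κ Φ t p D g f) (hL κ Φ t p D g f) (ℓL κ Φ t p D g f) (vL κ Φ t p D g f) := rfl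
      rw [this]; positivity
    have h1 : (0 : ℤ) ≤ ((((nL κ Φ t p D g f * ℓL κ Φ t p D g f / shearUnit (nL κ Φ t p D g f) (hL κ Φ t p D g f) + 1 : ℕ) : ℤ) - 1)) / 2 :=
      Int.ediv_nonneg (by have h' := hPd0; rw [hPd_def] at h'; push_cast at h' ⊢; linarith) (by norm_num)
    have h2 : (0 : ℤ) ≤ (s + kgΔY (kgR κ Φ t p D mk) 0) / 2 := Int.ediv_nonneg (by unfold Skelφ.kgΔY; positivity) (by norm_num)
    linarith
  have hcast : (((kgTgtY0 κ Φ t p D g f mk).toNat : ℕ) : ℤ) ≤ ((s.toNat * (21 * Neg.K κ + 2) : ℕ) : ℤ) := by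
    rw [Int.toNat_of_nonneg h0]; push_cast; rw [Int.toNat_of_nonneg hs0]; exact htgt
  exact Nat.div_le_of_le_mul (by exact_mod_cast hcast)

/-- **THE N-CORRIDOR FITS THE BUDGET** (`ρ := 0`): `N + 1 + (m₁+1) + (m₂+1) ≤ LfQ κ.K₀` at the second-axis values of record
(`(kgCorrSchedY …).N = N + 1 + m₁ + 1 + m₂`, `kgCorrSchedY_params`), under `EqNumL`, the box-slot floor and the residual floors `KGResY`. [this work] -/
theorem kgSchedNY_le_LfQ (hN : EqNumL κ Φ t p D g f) (hg : gFloorKG κ Φ t p D mk ≤ g) (hx : KGResY κ Φ t p D g f qx Wx) :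
    kgNYv0 κ Φ t p D g f mk qx Wx + 1 +
        (kgM₁Y (nL κ Φ t p D g f) (vL κ Φ t p D g f) (kgR κ Φ t p D mk) 0 (kgWY κ Φ t p D g f Wx) (kgNYv0 κ Φ t p D g f mk qx Wx) + 1) +
        (kgM₂Y (nL κ Φ t p D g f) (ℓL κ Φ t p D g f) (hL κ Φ t p D g f) (vL κ Φ t p D g f) (kgR κ Φ t p D mk) 0 (kgqY κ Φ t p D g f qx)
          (kgWY κ Φ t p D g f Wx) (kgNYv0 κ Φ t p D g f mk qx Wx) + 1) ≤ LfQ κ.K₀ := by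
  have H := kgYRows0_of κ Φ t p D g f mk qx Wx hN hg
  obtain ⟨hSn, hS, hR8, hbig, hρP⟩ := kgY_floors κ Φ t p D g f mk hN hg
  have hNle := kgNYv0_le κ Φ t p D g f mk qx Wx hN hg
  have hK := (Skelφ.NegPrm.forty_le_Kcell κ.K₀).1
  have hK' : (40 : ℤ) ≤ (Neg.K κ : ℤ) := by unfold Neg.K; exact_mod_cast hK
  have hNz : ((kgNYv0 κ Φ t p D g f mk qx Wx : ℕ) : ℤ) ≤ 21 * (Neg.K κ : ℤ) + 2 := by exact_mod_cast hNle
  have hP := H.sL_le_kgP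
  have hW : ((kgWY κ Φ t p D g f Wx : ℕ) : ℤ) ≤ 42 * (nL κ Φ t p D g f : ℤ) := by
    have hWx : Wx ≤ 40 * nL κ Φ t p D g f := hx.hWx
    unfold kgWY; push_cast
    have : ((Wx : ℕ) : ℤ) ≤ 40 * (nL κ Φ t p D g f : ℤ) := by exact_mod_cast hWx
    linarith
  have hq : ((kgqY κ Φ t p D g f qx : ℕ) : ℤ) ≤ 41 * kgSLY (nL κ Φ t p D g f) (ℓL κ Φ t p D g f) (hL κ Φ t p D g f) + 2 := by
    have hqx := hx.hqx
    have hPd := Skelφ.natDiv_le_kgSLY (one_le_of_eqNumL κ Φ t p D g f hN).1 (ℓL κ Φ t p D g f) (hL κ Φ t p D g f)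
    unfold kgqY
    push_cast [Nat.cast_add] at hPd ⊢
    linarith
  have hb := H.kgSchedNY_budget hSn hS hR8 hW hq hρP hbig hK' (kgNYv0 κ Φ t p D g f mk qx Wx) hNz
  have hZ : ((kgNYv0 κ Φ t p D g f mk qx Wx + 1 +
        (kgM₁Y (nL κ Φ t p D g f) (vL κ Φ t p D g f) (kgR κ Φ t p D mk) 0 (kgWY κ Φ t p D g f Wx) (kgNYv0 κ Φ t p D g f mk qx Wx) + 1) +
        (kgM₂Y (nL κ Φ t p D g f) (ℓL κ Φ t p D g f) (hL κ Φ t p D g f) (vL κ Φ t p D g f) (kgR κ Φ t p D mk) 0 (kgqY κ Φ t p D g f qx)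
          (kgWY κ Φ t p D g f Wx) (kgNYv0 κ Φ t p D g f mk qx Wx) + 1) : ℕ) : ℤ) ≤ ((LfQ κ.K₀ : ℕ) : ℤ) := by
    rw [LfQ_eq]; push_cast; linarith
  exact_mod_cast hZ

end ValuesY

end NegB

end PlanarSkeletonFrm

end Summit.CriticalPhenomena.PercolationContinuityZ3.Theorems.Transplant

end
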